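/-
COR-CM (cell pub-hodgecm2, stage 2 of the Hodge ladder) — Δ2 BRIDGE ∕ ¬hJ lane, HEAD-B risk item R1 («`J′^*_K` bijective»), brick (S-rep):
the rational level `U_K = levelQ Γ hΓ` of J1 (`TowerRationalForm`: coherent families of classes `c h ∈ H¹(P_{Γ_h}(ℂ); ℚ)` over ALL
component indices `h ∈ U(V)(𝔸_{L₀,f})`, `c h = t_γ^* (c h')` along `TowerLevel.Rel Γ γ h h'`) is FREE on a system of double-coset representatives:
`levelQ Γ hΓ ≃ₗ[ℚ] Π q, H¹(P_{Γ.conj (g q)}(ℂ); ℚ)` by evaluation ([Deligne1979ShimuraVarieties] 2.1.2: `X_K(ℂ) = ∐_{[g] ∈ G(ℚ)\G(𝔸_f)/K} Γ_g\X⁺`).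
The one geometric input: an element of a level's OWN arithmetic group translates trivially on cohomology (`pull_transMor_of_mem_Γ`:
`t_δ = id` on `Γ_h\𝔹` for `δ ∈ Γ_h`, from the uniformisation's fibre description `unif_eq_unif_iff`).
Seat prover-pub-hodgecm2-d2bridge-prove-5-g8-0 (author lineage of `ComponentAlbanesePin`); DESK file — no filing without the ¬hJ planner's word.
Theorems + one `def` (the evaluation equivalence); no named fact, no `sorry` intended; explicit binders.
HC_CM is NOT proved; nothing here asserts hJ, hJ₀ or their negations.
-/
import Summits.HodgeConjecture.CorCM.D2Bridge.Map43RecordAtPinLevels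
import Literature.NumberTheory.Automorphic.AdelicDoubleQuotientDissection
import HarnessLib

/-!
# The rational level `levelQ Γ` is free on double-coset representatives; `J^*_K` read at representatives

`levelQ Γ hΓ ≃ₗ[ℚ] Π q, H¹(P_{Γ.conj (g q)}(ℂ); ℚ)` by evaluation at a system `g` of representatives of
`U(V)(L₀)\U(V)(𝔸_f)/K` (`levelQEquivReps`; [Deligne1979ShimuraVarieties] 2.1.2), and hence, for any component-Albanese record `J`,
`J.albStarQ K` is bijective iff `x ↦ ((alb K (g q))^* x)_q` is (`bijective_albStarQ_iff_bijective_albStarReps_of_representatives`).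
Author d2bridge-prove-5 (desk `LevelQRepresentatives.lean` 8a1afa851dcc7a38, body byte-identical below); consumer: the ¬hJ HEAD-B R1
derivation `Summits/…/D2Bridge/NotHJAlbStarBijectiveOfLemma24.lean`.  HC_CM is NOT proved; nothing here asserts hJ, hJ₀ or their negations.
-/

set_option autoImplicit false

noncomputable section

open scoped Matrix
open Function NumberField Matrix
open Literature.AlgebraicGeometry.Motives
open Literature.AlgebraicGeometry.ShimuraVarieties
open Literature.AlgebraicGeometry.HodgeTheory
open Literature.NumberTheory.Automorphic
open Literature.NumberTheory.Automorphic.PicardCM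
open Literature.NumberTheory.Transcendental (Arapura2012_Cor_15_4_6)
open HodgeCM HodgeCM.Model HodgeCM.Model.LevelTranslate HodgeCM.Model.TowerLevel HodgeCM.Model.TowerCarrier
open Summit.HodgeConjecture.CorCM.D2Bridge.TowerRational

namespace Summit.HodgeConjecture.CorCM.D2Bridge.LevelQReps

variable (hHD : exists_isReal_hodgeModel) (hI : hodgePQ_independent_of_hodgeModel)
  (hU : BallQuotientUniformisedDatum) (h₃ : CMAbelianVarietyRealised) (hA : Arapura2012_Cor_15_4_6)
variable {L : HodgeCM.CMField} {ι₁ : L →+* ℂ} {V : HodgeCM.HermSpace3 L ι₁}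

/-! ## §1 An element of a level's own arithmetic group translates trivially -/

/-- `δ ∈ Δ.Γ` conjugates `Δ.Γ` into itself. [folklore] -/
theorem transCond_of_mem_Γ {Δ : HodgeCM.Level V} {δ : GL (Fin 3) L} (hδ : δ ∈ Δ.Γ) : TransCond δ Δ Δ :=
  TransCond.iff.mpr fun _ hx => Δ.Γ.mul_mem (Δ.Γ.mul_mem hδ hx) (Δ.Γ.inv_mem hδ)

/-- **`t_δ^* = id` for `δ` in the level's own arithmetic group**: the translate `Δ[v] ↦ Δ[δ^{ι₁} v]` of `X_Δ = Γ_Δ\𝔹` by an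
element `δ ∈ Γ_Δ` is the identity on complex points (`unif (δ v) = unif v`, the fibre description `unif_eq_unif_iff` of the
uniformisation), hence on `Hᵏ(X_Δ(ℂ); ℚ)` (`pull_congr`).  Off the anisotropic regime the translate is the identity by definition.
[cite: Deligne1979ShimuraVarieties, 2.1.2] -/
theorem pull_transMor_of_mem_Γ {Δ : HodgeCM.Level V} {δ : GL (Fin 3) L} (hδU : δ ∈ Urat V) (hδ : δ ∈ Δ.Γ)
    (ht : TransCond δ Δ Δ) (k : ℕ) :
    BettiUniverse.pull (transMor hU h₃ hHD hA hδU Δ Δ ht) k = LinearMap.id := by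
  rw [← BettiUniverse.pull_id]
  by_cases h : IsAnisotropic L V.Hm
  · have hΔ : (pmsCode L ι₁ V Δ).IsAnisotropic := (isAnisotropic_pmsCode_iff L ι₁ V Δ).2 h
    refine pull_congr (map_eq_of_unif hU h₃ hΔ fun v hv => ?_) k
    rw [map_transMor_unif hU h₃ hHD hA _ ht h hv, AlgPoints.map_id_apply]
    set D := Var.ballDatum hU h₃ (pmsCode L ι₁ V Δ) hΔ with hD
    have hmem : glι ι₁ δ ∈ D.Γ.map (Matrix.GeneralLinearGroup.map D.τ₁) := by
      rw [hD, ballDatum_map_Γ]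
      exact Subgroup.mem_map_of_mem _ hδ
    obtain ⟨γE, hγE, hγeq⟩ := Subgroup.mem_map.1 hmem
    have hv' : (glι ι₁ δ : Matrix (Fin 3) (Fin 3) ℂ) *ᵥ v ∈ D.cone :=
      HodgeCM.Model.LevelCoveringTwist.mulVec_mem_cone rfl (map_ι₁_mem_realPoints hU h₃ hδU Δ hΔ) hv
    refine (D.unif_eq_unif_iff _ hv' _ hv).2 ⟨γE⁻¹, D.Γ.inv_mem hγE, 1, one_ne_zero, ?_⟩
    rw [one_smul]
    have hmat : ((γE⁻¹ : GL (Fin 3) ↥D.E) : Matrix (Fin 3) (Fin 3) ↥D.E).map D.τ₁ =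
        (((glι ι₁ δ)⁻¹ : GL (Fin 3) ℂ) : Matrix (Fin 3) (Fin 3) ℂ) := by
      rw [← hγeq, ← map_inv]
      rfl
    change ((γE⁻¹ : GL (Fin 3) ↥D.E) : Matrix (Fin 3) (Fin 3) ↥D.E).map D.τ₁ *ᵥ ((glι ι₁ δ : Matrix (Fin 3) (Fin 3) ℂ) *ᵥ v) = v
    rw [hmat, mulVec_mulVec, ← Units.val_mul, inv_mul_cancel, Units.val_one, one_mulVec]
  · unfold transMor
    simp only [dif_neg h, CategoryTheory.eqToHom_refl]

/-- **Rational form**: `trPullQ δ Δ Δ _ k = id` for `δ ∈ Δ.Γ` (`trPullQ` IS `BettiUniverse.pull (transMor …)`, `universeOf_pull`). [folklore] -/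
theorem trPullQ_of_mem_Γ {Δ : HodgeCM.Level V} (δ : ↥(Urat V)) (hδ : (δ : GL (Fin 3) L) ∈ Δ.Γ)
    (ht : TransCond (δ : GL (Fin 3) L) Δ Δ) (k : ℕ) (x : CohQ hHD hI hU h₃ Δ k) :
    trPullQ hHD hI hU h₃ hA δ Δ Δ ht k x = x := by
  have e := pull_transMor_of_mem_Γ hHD hU h₃ hA δ.2 hδ ht k
  exact LinearMap.congr_fun e x

/-! ## §2 The relation and the arithmetic groups of the components -/

/-- **A self-relation `TowerLevel.Rel Γ δ h h` means `δ ∈ Γ_h`**: `h = (δ)_f h k` with `k ∈ K` says `(δ)_f = h k⁻¹ h⁻¹ ∈ h K h⁻¹`. [folklore] -/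
theorem mem_conj_Γ_of_rel_self {Γ : HodgeCM.Level V} (hΓ : Γ.BelowConjThree) {δ : ↥(Urat V)} {h : V.adelicFin}
    (r : TowerLevel.Rel Γ δ h h) : (δ : GL (Fin 3) L) ∈ (Γ.conj h hΓ).Γ := by
  obtain ⟨k, hk, hk'⟩ := r
  rw [Level.mem_conj_Γ_iff]
  refine ⟨δ.2, k⁻¹, Γ.K.inv_mem hk, ?_⟩
  -- `h k⁻¹ h⁻¹ = (δ)_f`
  have e : ρ V δ = h * k⁻¹ * h⁻¹ := by
    have := hk'
    -- h = ρ δ * h * k  ⇒  ρ δ = h * k⁻¹ * h⁻¹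
    calc ρ V δ = ρ V δ * h * k * k⁻¹ * h⁻¹ := by group
      _ = h * k⁻¹ * h⁻¹ := by rw [← this]
  exact e.symm

/-- **Rational composition law** `t_{γ₁}^* (t_{γ₂}^* x) = t_{γ₂ γ₁}^* x` on `Hᵏ(−; ℚ)` (from the complex `trPull_trPull` by
`trPull_tmul` + `one_tmul_injective`). [folklore] -/
theorem trPullQ_trPullQ {γ₁ γ₂ γ₃ : ↥(Urat V)} (e : γ₃ = γ₂ * γ₁) {Δ₁ Δ₂ Δ₃ : HodgeCM.Level V}
    (ht₁ : TransCond (γ₁ : GL (Fin 3) L) Δ₁ Δ₂) (ht₂ : TransCond (γ₂ : GL (Fin 3) L) Δ₂ Δ₃)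
    (ht₃ : TransCond (γ₃ : GL (Fin 3) L) Δ₁ Δ₃) (k : ℕ) (x : CohQ hHD hI hU h₃ Δ₃ k) :
    trPullQ hHD hI hU h₃ hA γ₁ Δ₁ Δ₂ ht₁ k (trPullQ hHD hI hU h₃ hA γ₂ Δ₂ Δ₃ ht₂ k x) =
      trPullQ hHD hI hU h₃ hA γ₃ Δ₁ Δ₃ ht₃ k x := by
  have key := trPull_trPull hHD hI hU h₃ hA e ht₁ ht₂ ht₃ k ((1 : ℂ) ⊗ₜ[ℚ] x)
  rw [trPull_tmul, trPull_tmul, trPull_tmul] at key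
  exact TensorProduct.one_tmul_injective ℚ ℂ _ key

/-- **Two translations of `h` to the same index agree on classes**: if `TowerLevel.Rel Γ γ h h'` and `TowerLevel.Rel Γ γ' h h'` then
`t_γ^* = t_{γ'}^*` on `H¹(P_{Γ_{h'}}; ℚ) → H¹(P_{Γ_h}; ℚ)` (`γ' γ⁻¹ ∈ Γ_{h'}` acts trivially). [folklore] -/
theorem trPullQ_eq_of_rel_rel {Γ : HodgeCM.Level V} (hΓ : Γ.BelowConjThree) {γ γ' : ↥(Urat V)} {h h' : V.adelicFin}
    (r : TowerLevel.Rel Γ γ h h') (r' : TowerLevel.Rel Γ γ' h h') (x : WQ hHD hI hU h₃ Γ hΓ h') :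
    trPullQ hHD hI hU h₃ hA γ (Γ.conj h hΓ) (Γ.conj h' hΓ) (transCond_of_rel hΓ r) 1 x =
      trPullQ hHD hI hU h₃ hA γ' (Γ.conj h hΓ) (Γ.conj h' hΓ) (transCond_of_rel hΓ r') 1 x := by
  -- `γ' = (γ' γ⁻¹) γ` and `TowerLevel.Rel Γ (γ' γ⁻¹) h' h'`
  have rself : TowerLevel.Rel Γ (γ' * γ⁻¹) h' h' := by
    obtain ⟨k, hk, rfl⟩ := r
    obtain ⟨k', hk', e'⟩ := r'
    refine ⟨k⁻¹ * k', Γ.K.mul_mem (Γ.K.inv_mem hk) hk', ?_⟩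
    rw [map_mul, map_inv]
    calc ρ V γ * h * k = ρ V γ' * h * k' := e'
      _ = ρ V γ' * (ρ V γ)⁻¹ * (ρ V γ * h * k) * (k⁻¹ * k') := by group
  have hmem := mem_conj_Γ_of_rel_self hΓ rself
  have htδ : TransCond ((γ' * γ⁻¹ : ↥(Urat V)) : GL (Fin 3) L) (Γ.conj h' hΓ) (Γ.conj h' hΓ) := transCond_of_mem_Γ hmem
  rw [← trPullQ_trPullQ hHD hI hU h₃ hA (γ₁ := γ) (γ₂ := γ' * γ⁻¹) (γ₃ := γ') (by group)
    (transCond_of_rel hΓ r) htδ (transCond_of_rel hΓ r') 1 x, trPullQ_of_mem_Γ hHD hI hU h₃ hA _ hmem htδ 1 x]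


/-! ## §3 `Rel` algebra -/

/-- Transitivity: `TowerLevel.Rel Γ γ₁ h h'` and `TowerLevel.Rel Γ γ₂ h' h''` give `TowerLevel.Rel Γ (γ₂ γ₁) h h''`. [folklore] -/
theorem rel_trans {Γ : HodgeCM.Level V} {γ₁ γ₂ : ↥(Urat V)} {h h' h'' : V.adelicFin} (r₁ : TowerLevel.Rel Γ γ₁ h h') (r₂ : TowerLevel.Rel Γ γ₂ h' h'') :
    TowerLevel.Rel Γ (γ₂ * γ₁) h h'' := by
  obtain ⟨k₁, hk₁, rfl⟩ := r₁
  obtain ⟨k₂, hk₂, rfl⟩ := r₂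
  refine ⟨k₁ * k₂, Γ.K.mul_mem hk₁ hk₂, ?_⟩
  rw [map_mul]
  group

/-- Two translations out of the same index: `TowerLevel.Rel Γ γ₁ h a` and `TowerLevel.Rel Γ γ₂ h b` give `TowerLevel.Rel Γ (γ₂ γ₁⁻¹) a b`. [folklore] -/
theorem rel_of_rel_rel {Γ : HodgeCM.Level V} {γ₁ γ₂ : ↥(Urat V)} {h a b : V.adelicFin} (r₁ : TowerLevel.Rel Γ γ₁ h a) (r₂ : TowerLevel.Rel Γ γ₂ h b) :
    TowerLevel.Rel Γ (γ₂ * γ₁⁻¹) a b := by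
  obtain ⟨k₁, hk₁, rfl⟩ := r₁
  obtain ⟨k₂, hk₂, rfl⟩ := r₂
  refine ⟨k₁⁻¹ * k₂, Γ.K.mul_mem (Γ.K.inv_mem hk₁) hk₂, ?_⟩
  rw [map_mul, map_inv]
  group

/-- `t_1^* = id` on one level, rational form. [folklore] -/
theorem trPullQ_one_self {Δ : HodgeCM.Level V} (ht : TransCond ((1 : ↥(Urat V)) : GL (Fin 3) L) Δ Δ) (k : ℕ)
    (x : CohQ hHD hI hU h₃ Δ k) : trPullQ hHD hI hU h₃ hA 1 Δ Δ ht k x = x :=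
  LinearMap.congr_fun (pull_transMor_one hU h₃ hHD hA (L := L) (ι₁ := ι₁) (V := V) (Δ := Δ) ht k) x

/-! ## §4 Evaluation at a system of representatives -/

section Reps

variable {Γ : HodgeCM.Level V} (hΓ : Γ.BelowConjThree) {Ξ : Type} (g : Ξ → V.adelicFin)

/-- **Evaluation of a rational level-`K` family at the indices `g q`.** [folklore] -/
def evalQ : levelQ hHD hI hU h₃ hA Γ hΓ →ₗ[ℚ] (Π q : Ξ, WQ hHD hI hU h₃ Γ hΓ (g q)) where
  toFun c q := (c : Π h : V.adelicFin, WQ hHD hI hU h₃ Γ hΓ h) (g q)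
  map_add' _ _ := rfl
  map_smul' _ _ := rfl

/-- Unfolding. [folklore] -/
@[simp] theorem evalQ_apply (c : levelQ hHD hI hU h₃ hA Γ hΓ) (q : Ξ) :
    evalQ hHD hI hU h₃ hA hΓ g c q = (c : Π h : V.adelicFin, WQ hHD hI hU h₃ Γ hΓ h) (g q) := rfl

/-- Crossing an equality of representatives: two translations of `h` to `g q = g q'` agree on a family of values `v`. [folklore] -/
theorem trPullQ_apply_eq_of_eq (v : Π q : Ξ, WQ hHD hI hU h₃ Γ hΓ (g q)) {h : V.adelicFin} {q q' : Ξ} (e : q = q')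
    {γ₁ γ₂ : ↥(Urat V)} (r₁ : TowerLevel.Rel Γ γ₁ h (g q)) (r₂ : TowerLevel.Rel Γ γ₂ h (g q')) :
    trPullQ hHD hI hU h₃ hA γ₁ (Γ.conj h hΓ) (Γ.conj (g q) hΓ) (transCond_of_rel hΓ r₁) 1 (v q) =
      trPullQ hHD hI hU h₃ hA γ₂ (Γ.conj h hΓ) (Γ.conj (g q') hΓ) (transCond_of_rel hΓ r₂) 1 (v q') := by
  subst e
  exact trPullQ_eq_of_rel_rel hHD hI hU h₃ hA hΓ r₁ r₂ (v q)

/-- **Injectivity**: a coherent family vanishing at every representative vanishes, as soon as every index is related to a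
representative. [cite: Deligne1979ShimuraVarieties, 2.1.2] -/
theorem evalQ_injective (hcov : ∀ h : V.adelicFin, ∃ (q : Ξ) (γ : ↥(Urat V)), TowerLevel.Rel Γ γ h (g q)) :
    Injective (evalQ hHD hI hU h₃ hA hΓ g) := by
  refine (injective_iff_map_eq_zero _).2 fun c hc => ?_
  apply Subtype.ext
  funext h
  obtain ⟨q, γ, r⟩ := hcov h
  have hq : (c : Π h : V.adelicFin, WQ hHD hI hU h₃ Γ hΓ h) (g q) = 0 := by
    have := congrFun hc q
    rwa [evalQ_apply] at this
  rw [(mem_levelQ_iff_rel hHD hI hU h₃ hA).1 c.2 γ h (g q) r, hq, map_zero]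
  rfl

/-- **Surjectivity**: any family of values at the representatives extends to a coherent family, as soon as every index is
related to a representative and distinct representatives are unrelated (the extension `c h := t_γ^* (v q)` for `TowerLevel.Rel Γ γ h (g q)`
is well defined by `trPullQ_eq_of_rel_rel`). [cite: Deligne1979ShimuraVarieties, 2.1.2] -/
theorem evalQ_surjective (hcov : ∀ h : V.adelicFin, ∃ (q : Ξ) (γ : ↥(Urat V)), TowerLevel.Rel Γ γ h (g q))
    (hirr : ∀ (q q' : Ξ) (γ : ↥(Urat V)), TowerLevel.Rel Γ γ (g q) (g q') → q = q') :
    Surjective (evalQ hHD hI hU h₃ hA hΓ g) := by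
  classical
  intro v
  choose qOf γOf rOf using hcov
  let c : Π h : V.adelicFin, WQ hHD hI hU h₃ Γ hΓ h := fun h =>
    trPullQ hHD hI hU h₃ hA (γOf h) (Γ.conj h hΓ) (Γ.conj (g (qOf h)) hΓ) (transCond_of_rel hΓ (rOf h)) 1 (v (qOf h))
  have hc : c ∈ levelQ hHD hI hU h₃ hA Γ hΓ := by
    refine (mem_levelQ_iff_rel hHD hI hU h₃ hA).2 fun γ' h h' r' => ?_
    have r2 : TowerLevel.Rel Γ (γOf h' * γ') h (g (qOf h')) := rel_trans r' (rOf h')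
    have hq : qOf h = qOf h' := hirr _ _ _ (rel_of_rel_rel (rOf h) r2)
    show trPullQ hHD hI hU h₃ hA (γOf h) (Γ.conj h hΓ) (Γ.conj (g (qOf h)) hΓ) (transCond_of_rel hΓ (rOf h)) 1 (v (qOf h)) =
      trPullQ hHD hI hU h₃ hA γ' (Γ.conj h hΓ) (Γ.conj h' hΓ) (transCond_of_rel hΓ r') 1
        (trPullQ hHD hI hU h₃ hA (γOf h') (Γ.conj h' hΓ) (Γ.conj (g (qOf h')) hΓ) (transCond_of_rel hΓ (rOf h')) 1 (v (qOf h')))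
    rw [trPullQ_trPullQ hHD hI hU h₃ hA (γ₃ := γOf h' * γ') rfl (transCond_of_rel hΓ r') (transCond_of_rel hΓ (rOf h'))
      (transCond_of_rel hΓ r2) 1 (v (qOf h'))]
    exact trPullQ_apply_eq_of_eq hHD hI hU h₃ hA hΓ g v hq (rOf h) r2
  refine ⟨⟨c, hc⟩, funext fun q₀ => ?_⟩
  have hq : qOf (g q₀) = q₀ := (hirr _ _ _ (rOf (g q₀))).symm
  rw [evalQ_apply]
  show trPullQ hHD hI hU h₃ hA (γOf (g q₀)) (Γ.conj (g q₀) hΓ) (Γ.conj (g (qOf (g q₀))) hΓ) (transCond_of_rel hΓ (rOf (g q₀))) 1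
      (v (qOf (g q₀))) = v q₀
  rw [trPullQ_apply_eq_of_eq hHD hI hU h₃ hA hΓ g v hq (rOf (g q₀)) (Rel.refl (g q₀))]
  exact trPullQ_one_self hHD hI hU h₃ hA _ 1 (v q₀)

/-- **(S-rep) The rational level is free on a system of double-coset representatives**:
`levelQ Γ hΓ ≃ₗ[ℚ] Π q, H¹(P_{Γ.conj (g q)}(ℂ); ℚ)` by evaluation, for `g : Ξ → U(V)(𝔸_f)` meeting every class of `TowerLevel.Rel Γ`
exactly once. [cite: Deligne1979ShimuraVarieties, 2.1.2] -/
def levelQEquivOfReps (hcov : ∀ h : V.adelicFin, ∃ (q : Ξ) (γ : ↥(Urat V)), TowerLevel.Rel Γ γ h (g q))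
    (hirr : ∀ (q q' : Ξ) (γ : ↥(Urat V)), TowerLevel.Rel Γ γ (g q) (g q') → q = q') :
    levelQ hHD hI hU h₃ hA Γ hΓ ≃ₗ[ℚ] (Π q : Ξ, WQ hHD hI hU h₃ Γ hΓ (g q)) :=
  LinearEquiv.ofBijective (evalQ hHD hI hU h₃ hA hΓ g)
    ⟨evalQ_injective hHD hI hU h₃ hA hΓ g hcov, evalQ_surjective hHD hI hU h₃ hA hΓ g hcov hirr⟩

/-- Unfolding of the equivalence. [folklore] -/
@[simp] theorem levelQEquivOfReps_apply (hcov : ∀ h : V.adelicFin, ∃ (q : Ξ) (γ : ↥(Urat V)), TowerLevel.Rel Γ γ h (g q))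
    (hirr : ∀ (q q' : Ξ) (γ : ↥(Urat V)), TowerLevel.Rel Γ γ (g q) (g q') → q = q') (c : levelQ hHD hI hU h₃ hA Γ hΓ) (q : Ξ) :
    levelQEquivOfReps hHD hI hU h₃ hA hΓ g hcov hirr c q = (c : Π h : V.adelicFin, WQ hHD hI hU h₃ Γ hΓ h) (g q) := rfl

end Reps


/-! ## §5 Double-coset representatives meet every class of `TowerLevel.Rel Γ` exactly once -/

section DoubleCoset

open MulAction
open Literature.NumberTheory.Automorphic.ShimuraDissection

variable {Γ : HodgeCM.Level V}

/-- **Cover**: for representatives `g` of the double cosets `U(V)(L₀)\U(V)(𝔸_f)/K` (the index set `Ξ_K` of the record's pieces,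
`RecordSystem.pieces`: `⟦g_q K⟧ = q`), every index `h` is `TowerLevel.Rel Γ`-related to the representative of its class.
[cite: Deligne1979ShimuraVarieties, 2.1.2] [cite: Milne2005ShimuraVarieties, Lemma 5.13] -/
theorem exists_rel_of_representatives (g : orbitRel.Quotient ↥(Urat V) (CosetSpace (ρ V) Γ.K) → V.adelicFin)
    (hg : ∀ q, (Quotient.mk'' (CosetSpace.pt (ρ V) Γ.K (g q)) : orbitRel.Quotient ↥(Urat V) (CosetSpace (ρ V) Γ.K)) = q)
    (h : V.adelicFin) :
    ∃ (q : orbitRel.Quotient ↥(Urat V) (CosetSpace (ρ V) Γ.K)) (γ : ↥(Urat V)), TowerLevel.Rel Γ γ h (g q) := by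
  refine ⟨Quotient.mk'' (CosetSpace.pt (ρ V) Γ.K h), ?_⟩
  obtain ⟨γ, hγ⟩ := (Quotient.eq''.trans mem_orbit_iff).1 (hg (Quotient.mk'' (CosetSpace.pt (ρ V) Γ.K h)))
  refine ⟨γ, (ρ V γ * h)⁻¹ * g _, ?_, (mul_inv_cancel_left _ _).symm⟩
  rw [CosetSpace.smul_pt, CosetSpace.pt_eq_pt_iff] at hγ
  exact hγ

/-- **Irredundancy**: two representatives that are `TowerLevel.Rel Γ`-related are equal. [cite: Milne2005ShimuraVarieties, Lemma 5.13] -/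
theorem eq_of_rel_representatives (g : orbitRel.Quotient ↥(Urat V) (CosetSpace (ρ V) Γ.K) → V.adelicFin)
    (hg : ∀ q, (Quotient.mk'' (CosetSpace.pt (ρ V) Γ.K (g q)) : orbitRel.Quotient ↥(Urat V) (CosetSpace (ρ V) Γ.K)) = q)
    {q q' : orbitRel.Quotient ↥(Urat V) (CosetSpace (ρ V) Γ.K)} {γ : ↥(Urat V)} (r : TowerLevel.Rel Γ γ (g q) (g q')) : q = q' := by
  obtain ⟨k, hk, e⟩ := r
  rw [← hg q, ← hg q']
  refine ((Quotient.eq''.trans mem_orbit_iff).2 ⟨γ, ?_⟩).symm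
  -- `γ • (g q) K = (g q') K`
  rw [CosetSpace.smul_pt, CosetSpace.pt_eq_pt_iff, e]
  have : ((ρ V) γ * g q)⁻¹ * ((ρ V) γ * g q * k) = k := by group
  rw [this]
  exact hk

/-- **(S-rep) at the record's index set**: `levelQ Γ hΓ ≃ₗ[ℚ] Π q : Ξ_K, H¹(P_{Γ.conj (g q)}(ℂ); ℚ)` for any system `g` of
double-coset representatives. [cite: Deligne1979ShimuraVarieties, 2.1.2] -/
def levelQEquivReps (hΓ : Γ.BelowConjThree) (g : orbitRel.Quotient ↥(Urat V) (CosetSpace (ρ V) Γ.K) → V.adelicFin)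
    (hg : ∀ q, (Quotient.mk'' (CosetSpace.pt (ρ V) Γ.K (g q)) : orbitRel.Quotient ↥(Urat V) (CosetSpace (ρ V) Γ.K)) = q) :
    levelQ hHD hI hU h₃ hA Γ hΓ ≃ₗ[ℚ] (Π q : orbitRel.Quotient ↥(Urat V) (CosetSpace (ρ V) Γ.K), WQ hHD hI hU h₃ Γ hΓ (g q)) :=
  levelQEquivOfReps hHD hI hU h₃ hA hΓ g (exists_rel_of_representatives g hg)
    (fun _ _ _ r => eq_of_rel_representatives g hg r)

/-- Unfolding. [folklore] -/
@[simp] theorem levelQEquivReps_apply (hΓ : Γ.BelowConjThree)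
    (g : orbitRel.Quotient ↥(Urat V) (CosetSpace (ρ V) Γ.K) → V.adelicFin)
    (hg : ∀ q, (Quotient.mk'' (CosetSpace.pt (ρ V) Γ.K (g q)) : orbitRel.Quotient ↥(Urat V) (CosetSpace (ρ V) Γ.K)) = q)
    (c : levelQ hHD hI hU h₃ hA Γ hΓ) (q : orbitRel.Quotient ↥(Urat V) (CosetSpace (ρ V) Γ.K)) :
    levelQEquivReps hHD hI hU h₃ hA hΓ g hg c q = (c : Π h : V.adelicFin, WQ hHD hI hU h₃ Γ hΓ h) (g q) := rfl

/-- Representatives exist (`ShimuraDissection.exists_representatives`), so the rational level is (non-canonically) a finite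
product of the `H¹` of component surfaces. [cite: Milne2005ShimuraVarieties, Lemma 5.13] -/
theorem nonempty_levelQ_linearEquiv_pi (hΓ : Γ.BelowConjThree) :
    ∃ g : orbitRel.Quotient ↥(Urat V) (CosetSpace (ρ V) Γ.K) → V.adelicFin,
      (∀ q, (Quotient.mk'' (CosetSpace.pt (ρ V) Γ.K (g q)) : orbitRel.Quotient ↥(Urat V) (CosetSpace (ρ V) Γ.K)) = q) ∧
      Nonempty (levelQ hHD hI hU h₃ hA Γ hΓ ≃ₗ[ℚ]
        (Π q : orbitRel.Quotient ↥(Urat V) (CosetSpace (ρ V) Γ.K), WQ hHD hI hU h₃ Γ hΓ (g q))) := by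
  obtain ⟨g, hg⟩ := exists_representatives (ρ V) Γ.K
  exact ⟨g, hg, ⟨levelQEquivReps hHD hI hU h₃ hA hΓ g hg⟩⟩

end DoubleCoset


/-! ## §6 `J^*_K` through the representatives: R1 reduces to «Lem. 2.4 (1) at the components `g q`» -/

section AlbStar

open Literature.AlgebraicGeometry.ShimuraVarieties.UnitaryCanonicalModel (exists_recordSystem)
open Literature.NumberTheory.Automorphic.Liu2021 Literature.NumberTheory.Automorphic.Liu2021.AppendixC

variable {h : exists_recordSystem} {Φ : Literature.AlgebraicGeometry.Motives.CMType L} {isotropicAt : ℕ → Prop}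
  {C : Sec42Data (Model.honestP5Of h ⟨L.K⟩ ι₁ ⟨V.Hm, V.isHermitian, V.signature_ι₁, V.posDef_of_ne⟩ Φ) isotropicAt}
  {T : C.HeckeTranslates} [Algebra L ℂ]
variable (J : ComponentAlbanese hHD hI hU h₃ hA V h Φ C T) (K : C5.SmallLevel C.S.K₀) {Ξ : Type} (g : Ξ → V.adelicFin)

/-- **`J^*_K` read at the representatives only**: `x ↦ ((alb K (g q))^* x)_q`, i.e. `evalQ ∘ albStarQ K`.
[cite: Liu2021, proof of Lemma 2.4 (1) (FJcycle.tex l. 1220–1228)] -/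
def albStarReps : bettiCohomology ((C.A K).baseChange ℂ).X 1 →ₗ[ℚ] (Π q : Ξ, WQ hHD hI hU h₃ (J.Γof K) (J.belowConjThree K) (g q)) :=
  evalQ hHD hI hU h₃ hA (J.belowConjThree K) g ∘ₗ J.albStarQ K

/-- Unfolding: the `q`-component is the honest Betti pull-back along `alb K (g q)`. [folklore] -/
@[simp] theorem albStarReps_apply (x : bettiCohomology ((C.A K).baseChange ℂ).X 1) (q : Ξ) :
    albStarReps hHD hI hU h₃ hA J K g x q = BettiUniverse.pull (J.alb K (g q)) 1 x := rfl

/-- **R1 ⟺ «Lem. 2.4 (1) at the representatives»**: for a system `g` of representatives of the classes of `TowerLevel.Rel (J.Γof K)`,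
`J.albStarQ K` is bijective iff `x ↦ ((alb K (g q))^* x)_q : H¹((A_K ⊗ ℂ)(ℂ); ℚ) → Π_q H¹(P_{Γ_K.conj (g q)}(ℂ); ℚ)` is bijective
(the evaluation `levelQEquivOfReps` is an isomorphism).  So the displayed∕to-be-built content of R1 is exactly [Liu2021] Lem. 2.4 (1)
`H¹(Alb_{X_K} ⊗ ℂ) ≅ H¹(X_K ⊗ ℂ) = ⊕_q H¹(P_{g q})` read on the finitely many components, with no tower bookkeeping left in it.
[cite: Liu2021, Lemma 2.4 (1) (FJcycle.tex l. 1210–1228)] [cite: Deligne1979ShimuraVarieties, 2.1.2] -/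
theorem bijective_albStarQ_iff_bijective_albStarReps
    (hcov : ∀ hh : V.adelicFin, ∃ (q : Ξ) (γ : ↥(Urat V)), TowerLevel.Rel (J.Γof K) γ hh (g q))
    (hirr : ∀ (q q' : Ξ) (γ : ↥(Urat V)), TowerLevel.Rel (J.Γof K) γ (g q) (g q') → q = q') :
    Bijective (J.albStarQ K) ↔ Bijective (albStarReps hHD hI hU h₃ hA J K g) := by
  have he : Bijective (evalQ hHD hI hU h₃ hA (J.belowConjThree K) g) :=
    (levelQEquivOfReps hHD hI hU h₃ hA (J.belowConjThree K) g hcov hirr).bijective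
  exact (he.of_comp_iff' (J.albStarQ K)).symm

/-- The same at the record's double-coset index set `Ξ_K = U(V)(L₀)\U(V)(𝔸_f)/K` (`K = (J.Γof K).K`), for representatives `g` with
`⟦(g q) K⟧ = q` — the shape delivered by `RecordSystem.pieces` ∕ `exists_representatives`. [cite: Deligne1979ShimuraVarieties, 2.1.2] -/
theorem bijective_albStarQ_iff_bijective_albStarReps_of_representatives
    (g : MulAction.orbitRel.Quotient ↥(Urat V)
      (Literature.NumberTheory.Automorphic.ShimuraDissection.CosetSpace (ρ V) (J.Γof K).K) → V.adelicFin)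
    (hg : ∀ q, (Quotient.mk'' (Literature.NumberTheory.Automorphic.ShimuraDissection.CosetSpace.pt (ρ V) (J.Γof K).K (g q)) :
      MulAction.orbitRel.Quotient ↥(Urat V)
        (Literature.NumberTheory.Automorphic.ShimuraDissection.CosetSpace (ρ V) (J.Γof K).K)) = q) :
    Bijective (J.albStarQ K) ↔ Bijective (albStarReps hHD hI hU h₃ hA J K g) :=
  bijective_albStarQ_iff_bijective_albStarReps hHD hI hU h₃ hA J K g (exists_rel_of_representatives g hg)
    (fun _ _ _ r => eq_of_rel_representatives g hg r)

end AlbStar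

end Summit.HodgeConjecture.CorCM.D2Bridge.LevelQReps

end
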